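import Summits.CriticalPhenomena.PercolationContinuityZ3.Theorems.Transplant.SkelPhiConcRealised
import Summits.CriticalPhenomena.PercolationContinuityZ3.Theorems.Transplant.PlanarCells2Sep
import Summits.CriticalPhenomena.PercolationContinuityZ3.Theorems.Transplant.PlanarCells2Contain
import HarnessLib

/-!
# D″ node, STRUCTURE-FREE layer L6′ (C) part 3a: the FRESH HABITAT of the corridor test over the two-unit cells — planar supplements for
# `PCells2` (`Q_y ∪ H_{y,du}`: coordinate bounds, column depth, self-adjacency, disjointness from the incoming between-box), the staircase step
# device at φ-level, and `Skelφ.habΩ` with its cube/corridor dichotomy — the re-cut of `SkelConcReachHab` §0–§1 and §3 (definitions) per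
# DPRIME-SCOPE §2 L6′ (C) / p3 addendum K; §2 of the source (`Skel.isSubbox_Wcor_hab`) is Φ-free and stays IMPORTED (K2.5), §4 (the residue
# in habitat form) waits for the LEVEL-1 band-chain record and is the next file

builds on p205010 (kernel theorem, internal audit signed; external expert review pending) — nothing in this file uses p205010.
Lane `prim-bschramm`, seat `prim-bschramm-p5` (gen 6; (C) column, DPRIME K.4), helper file (`--supports stmt-CriticalPhenomena-4575`).  NEW FILE.
Dictionary: `C : PCells ↦ P : PCells2` (one unit `r` ↦ two units `r i`; bounds stated with `P.rmax` where the consumer only needs a uniform one),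
`Φ ↦ (G, φ)` with `hstep : Steps G φ` for the step device, `cellGeomSG Φ C ↦ Skelφ.cellGeomSG G φ P`, `faceDataSG` likewise.
* §0 `PCells2.abs_sub_cen_le_of_mem_Q_union_Hfull` (`|x₀ i − cen y i| ≤ 22 r_i`), **`PCells2.norm_le_of_mem_Q_union_Hfull`** (`‖x₀‖₁ ≤ 20·rmax·‖y‖₁ + 44·rmax`),
  **`PCells2.BtwN_disjoint_Q_union_Hfull`** (`PCells2.exists_adj_of_mem_Hfull` is hp-8's, `PlanarCells2Sep`);
* §1 **`Skelφ.mem_VStair_of_zdAdj (hstep)`** (the step device, staircase form);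
* §2 **`Skelφ.habΩ G φ P t Λ q δc h e a' du`** (`E^{α}_{x,y} ∪ H^{a'}_{y,y+du}`), `Skelφ.mem_Q_or_Hfull_of_mem_habΩ`.
[cite: KozmaNitzan2024, §4 p. 26 (E_{v,x}, H_{v,x}, Figure 3), p. 30 (Step IV), p. 31]
-/

noncomputable section

open scoped Classical

namespace Summit.CriticalPhenomena.PercolationContinuityZ3.Theorems

namespace Transplant

/-! ## §0 Planar supplements for the two-unit cells -/

namespace PCells2

open Literature.Probability.Percolation Literature.Probability.LatticeModels SimpleGraph Contour
open Literature.Probability.Percolation.KozmaNitzan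
open Literature.Probability.Percolation.KozmaNitzan.Cells (oth oth_ne eq_oth_of_ne sgOf sgOf_sign stepVec_apply_fst stepVec_apply_oth)

variable (P : PCells2)

/-- A point of `Q y ∪ H_{y,du}` is within `22 r_i` of `cen y` in coordinate `i`. [folklore] -/
theorem abs_sub_cen_le_of_mem_Q_union_Hfull (y : Site 2) (du : MDir) {x₀ : Site 2} (hx : x₀ ∈ P.Q y ∪ P.Hfull y du) (i : Fin 2) :
    |x₀ i - P.cen y i| ≤ 22 * (P.r i : ℤ) := by
  have hr : (0 : ℤ) ≤ P.r i := by positivity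
  rcases Finset.mem_union.1 hx with h | h
  · rw [PCells2.Q, P.mem_abox_iff] at h
    have := h i
    push_cast at this
    rw [abs_le]; constructor <;> linarith
  · rw [PCells2.Hfull, mem_sBox_iff (sgOf_sign du)] at h
    obtain ⟨⟨h1, h2⟩, h3⟩ := h
    by_cases hi : i = du.1
    · subst hi
      rcases sgOf_sign du with hs | hs <;> rw [hs] at h1 h2 <;> rw [abs_le] <;> constructor <;> linarith
    · have h4 := h3 i hi
      have hoi : P.r (oth du.1) = P.r i := by rw [← eq_oth_of_ne hi]
      rw [hoi] at h4
      rw [abs_le]; constructor <;> linarith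

/-- **Column depth bound**: a point of `Q y ∪ H_{y,du}` has ℓ¹-norm `≤ 20·rmax·‖y‖₁ + 44·rmax`. [folklore] -/
theorem norm_le_of_mem_Q_union_Hfull (y : Site 2) (du : MDir) {x₀ : Site 2} (hx : x₀ ∈ P.Q y ∪ P.Hfull y du) :
    (x₀ 0).natAbs + (x₀ 1).natAbs ≤ 20 * P.rmax * ((y 0).natAbs + (y 1).natAbs) + 44 * P.rmax := by
  have key : ∀ i : Fin 2, |x₀ i| ≤ 20 * (P.rmax : ℤ) * |y i| + 22 * P.rmax := by
    intro i
    have h := P.abs_sub_cen_le_of_mem_Q_union_Hfull y du hx i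
    simp only [PCells2.cen_apply] at h
    have hri : (P.r i : ℤ) ≤ P.rmax := by exact_mod_cast P.r_le_rmax i
    have hr : (0 : ℤ) ≤ P.r i := by positivity
    have hy : (0 : ℤ) ≤ |y i| := abs_nonneg _
    calc |x₀ i| = |(x₀ i - 20 * (P.r i : ℤ) * y i) + 20 * (P.r i : ℤ) * y i| := by ring_nf
      _ ≤ |x₀ i - 20 * (P.r i : ℤ) * y i| + |20 * (P.r i : ℤ) * y i| := abs_add_le _ _
      _ ≤ 22 * P.r i + 20 * (P.r i : ℤ) * |y i| := by
          rw [abs_mul, abs_of_nonneg (by positivity : (0:ℤ) ≤ 20 * P.r i)]; linarith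
      _ ≤ 20 * (P.rmax : ℤ) * |y i| + 22 * P.rmax := by nlinarith
  have e0 : ((x₀ 0).natAbs : ℤ) = |x₀ 0| := Int.natCast_natAbs _
  have e1 : ((x₀ 1).natAbs : ℤ) = |x₀ 1| := Int.natCast_natAbs _
  have f0 : ((y 0).natAbs : ℤ) = |y 0| := Int.natCast_natAbs _
  have f1 : ((y 1).natAbs : ℤ) = |y 1| := Int.natCast_natAbs _
  have k0 := key 0
  have k1 := key 1
  have : ((x₀ 0).natAbs : ℤ) + (x₀ 1).natAbs ≤ 20 * P.rmax * (((y 0).natAbs : ℤ) + (y 1).natAbs) + 44 * P.rmax := by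
    rw [e0, e1, f0, f1]; nlinarith
  exact_mod_cast this

/-- **The incoming between-box misses the cube and the onward corridor of the target**: `BtwN x δ ∩ (Q y ∪ H_{y,du}) = ∅` for `y = x + δ`,
`du ≠ rev δ`. [cite: KozmaNitzan2024, §4 p. 26 (Figure 3)] -/
theorem BtwN_disjoint_Q_union_Hfull (x : Site 2) (δ : MDir) {du : MDir} (hdu : du ≠ rev δ) :
    Disjoint (P.BtwN x δ) (P.Q (x + stepVec δ) ∪ P.Hfull (x + stepVec δ) du) := by
  rw [Finset.disjoint_union_right]
  refine ⟨(P.Q_disjoint_BtwN (x + stepVec δ) x δ).symm, Finset.disjoint_left.2 fun t ht ht' => ?_⟩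
  rcases Finset.mem_union.1 (P.Hfull_subset_Q_union_EfarN _ du ht') with h | h
  · exact Finset.disjoint_left.1 (P.Q_disjoint_BtwN (x + stepVec δ) x δ).symm ht h
  · have hE := P.EwvN_disjoint_EfarN x hdu
    rw [PCells2.EwvN, Finset.disjoint_union_left] at hE
    exact Finset.disjoint_left.1 hE.1 ht h

end PCells2

/-! ## §1 The step device into a staircase span, φ-level -/

namespace Skelφ

open Literature.Probability.Percolation Literature.Probability.LatticeModels SimpleGraph GadgetSystem Contour KNCells
open Literature.Barriers.CriticalPhenomena (graphBall graphBall_mono)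
open BoxProdZ2 (ConcRadiiG)
open PlanarSkeletonConc (exists_single_of_zdAdj mem_vspan_edgesIn_iff mem_vspan_edgesIn_of_adj)

variable {V : Type} [DecidableEq V] {G : SimpleGraph V} [G.LocallyFinite] {φ : V → Site 2}

/-- **The step device, staircase form**: under (ι) steps, a vertex of depth `≤ n`, footprint in `P` with a `ℤ²`-neighbour of the footprint in `P`,
and `n + 1 ≤ ρ` at both footprints, lies in the staircase span `VStair P ρ`. [this work] -/
theorem mem_VStair_of_zdAdj (hstep : Steps G φ) {w₀ : V} {Pl : Finset (Site 2)} {ρ : Site 2 → ℕ} {n : ℕ} {y : V} (hy : y ∈ graphBall G w₀ n)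
    (hP : φ y ∈ Pl) (hself : ∃ t' ∈ Pl, (zdGraph 2).Adj (φ y) t' ∧ n + 1 ≤ ρ t') (hn : n + 1 ≤ ρ (φ y)) : y ∈ VStair G φ w₀ Pl ρ := by
  obtain ⟨t', ht', hadj, hn'⟩ := hself
  obtain ⟨i, σ, rfl⟩ := exists_single_of_zdAdj hadj
  obtain ⟨y', hyy', hφ⟩ := hstep y i σ
  refine (mem_vspan_edgesIn_of_adj ?_ ?_ hyy').1
  · exact mem_stair.2 ⟨hP, graphBall_mono G w₀ (by omega) hy⟩
  · refine mem_stair.2 ⟨hφ ▸ ht', ?_⟩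
    rw [hφ]
    exact graphBall_mono G w₀ hn' (BoxProdZ2.mem_graphBall_succ_of_adj G hy hyy')

/-! ## §2 The fresh habitat of the corridor test of the scheme of record -/

section Conc

variable (G φ) (P : PCells2) (t : V) {Λ : ConcRadiiG}

/-- **The fresh habitat of the corridor test** at `(h, e, a', du)`: `E^{α}_{x,y} ∪ H^{a'}_{y,y+du}`, `α = aOf₁`. [cite: KozmaNitzan2024, §4 p. 30] -/
def habΩ (q : unitInterval) (δc : ℝ) (h : ProbeHistory V) (e : Site 2 × MDir) (a' : ℕ) (du : MDir) : Finset V :=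
  (⟨cellGeomSG G φ P t Λ, q, δc⟩ : KSchA V ℕ).Γ.Ewv ((⟨cellGeomSG G φ P t Λ, q, δc⟩ : KSchA V ℕ).aOf₁ G h e) e.1 e.2 ∪
    (faceDataSG G φ P t Λ).Hfull a' (tgt e) du

variable {G φ P t}

/-- A vertex of the fresh habitat with footprint in `Q y ∪ H_{y,du}` lies in the cube span `Q_α(y)` or in the corridor span `H` (the incoming
between-box is planar-disjoint from both). [folklore] -/
theorem mem_Q_or_Hfull_of_mem_habΩ {q : unitInterval} {δc : ℝ} {h : ProbeHistory V} {e : Site 2 × MDir} {a' : ℕ} {du : MDir}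
    (hdu : du ≠ rev e.2) {v : V} (hv : v ∈ habΩ G φ P t (Λ := Λ) q δc h e a' du) (hφ : φ v ∈ P.Q (tgt e) ∪ P.Hfull (tgt e) du) :
    v ∈ (cellGeomSG G φ P t Λ).Q ((⟨cellGeomSG G φ P t Λ, q, δc⟩ : KSchA V ℕ).aOf₁ G h e) (tgt e) ∨ v ∈ (faceDataSG G φ P t Λ).Hfull a' (tgt e) du := by
  rcases Finset.mem_union.1 hv with hv | hv
  · rcases Finset.mem_union.1 hv with hv | hv
    · -- the between-box: planar contradiction
      have hB : φ v ∈ P.BtwN e.1 e.2 := φ_mem_of_mem_VWin hv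
      exact absurd hφ (Finset.disjoint_left.1 (P.BtwN_disjoint_Q_union_Hfull e.1 e.2 hdu) hB)
    · exact Or.inl hv
  · exact Or.inr hv

/-- The fresh habitat lies in the habitat `hout` shape consumed by `Skelφ.hout_Wcor` (`SkelPhiConcHout`): it IS `E_{v,x} ∪ H`. [folklore] -/
theorem habΩ_eq {q : unitInterval} {δc : ℝ} {h : ProbeHistory V} {e : Site 2 × MDir} {a' : ℕ} {du : MDir} :
    habΩ G φ P t (Λ := Λ) q δc h e a' du =
      (cellGeomSG G φ P t Λ).Ewv ((⟨cellGeomSG G φ P t Λ, q, δc⟩ : KSchA V ℕ).aOf₁ G h e) e.1 e.2 ∪ (faceDataSG G φ P t Λ).Hfull a' (tgt e) du := rfl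

end Conc

end Skelφ

end Transplant

end Summit.CriticalPhenomena.PercolationContinuityZ3.Theorems

end
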